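import Summits.ValiantsHypothesis.ValiantsHypothesis.Theses.RyserTripartition
import Literature.Computability.AlgebraicComplexity.TripartitionTensor
import Literature.Computability.AlgebraicComplexity.MatrixMultiplicationExponent

/-!
# Birth skeleton for crux `TripartitionHard` (item stmt-ValiantsHypothesis-7160)

Route `route-ValiantsHypothesis-RyserTripartition` (rank-2 crux). Crux (route decl
`Summit.ValiantsHypothesis.ValiantsHypothesis.Theses.RyserTripartition.TripartitionHard`):
for every `ε > 0` and all large `k`, every fan-in-two circuit over `ℂ` computing Pratt's
balanced-tripartition cubic form `T_k = Σ_{S ⊔ T ⊔ U = [3k]} X_(0,S) X_(1,T) X_(2,U)`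
(`N = C(3k,k)` variables per group) has size `≥ 8^{(1−ε)k}` (`= N^{1.089−o(1)}`).

LINE (the route's own two-layer plan "TripartitionHard ⇐ TripartitionRankHard → RankToCircuit",
sharpened by refuter rreview-70aad721-g2 / grounder g15-32 on the item): a circuit lower bound for a
TRILINEAR FORM follows from a TENSOR-RANK lower bound for its coefficient tensor, because circuit
size bounds rank linearly — Baur–Strassen's derivative inequality (all `∂F/∂X_(0,a)` for `3·L`
nonscalar multiplications, BCS 1997 Thm. (7.7)) followed by `R ≤ 2·L^{ns}` for the resulting set of
bilinear forms (BCS 1997 Prop. (14.1)/(14.8)). Both ingredients are PROVED in the tree's circuit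
model (`exists_isNonscalarSeq_length_le_complexity`, `exists_isNonscalarSeq_forall_pderiv`,
`exists_triads_of_isNonscalarSeq`); what is missing is their assembly for cubic forms (STUB 1, M)
and — the whole difficulty of the crux, now isolated as a statement about an explicit 0/1 tensor —
the rank lower bound `R(T_k) ≥ 8^{(1−ε)k}` (STUB 2; Pratt 2024 Cor. 1.12 derives it from the Set
Cover Conjecture via the tree's named fact `pratt2024_cor_1_12`; unconditionally it is an explicit
super-linear rank bound `R ≥ N^{1.089−o(1)}` beyond the `8N` rank-method ceiling, EGOW 2018).

* `stub_rankLeComplexity` — for some absolute `c`: for every finite index type `ι` and cubic tensor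
  `t : ι → ι → ι → ℂ`, `R(t) ≤ c · L(F_t)` where `F_t = Σ C(t i j l) X_(0,i) X_(1,j) X_(2,l) ∈
  ℂ[Fin 3 × ι]` is the associated trilinear form and `L` = fan-in-two `complexity` (`c = 6` works).
* `stub_rankHard` — `∀ ε > 0, ∃ k₀, ∀ k ≥ k₀, 8^{(1−ε)k} ≤ R(tripartitionTensor ℂ k)`.

`TripartitionHard_of` assembles them (real proof): `F_{T_k}` IS the crux's inlined polynomial
(`trilinear_tripartitionTensor_eq`, `tripartitionTensor_apply` + `C 1 = 1`, `C 0 = 0`); given `ε`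
put `δ := min ε 1`, take `k₁` from STUB 2 at `δ/2` and `k₂` with `c < (8^{δ/2})^{k₂}`
(Archimedes); for `k ≥ max k₁ k₂`:
`8^{(1−ε)k} ≤ 8^{(1−δ)k}` and `8^{(1−δ)k} · 8^{(δ/2)k} = 8^{(1−δ/2)k} ≤ R(T_k) ≤ c·L ≤ 8^{(δ/2)k}·L`,
so `8^{(1−δ)k} ≤ L`.

## Shape (skeleton audit by-name rule, as in `Cruxes/Depth3Chasm/Lines/birth.lean`)
* `Stmt.stub_…` — the two stub statements as precise `Prop`s, named like the stubs;
* `stub_…` — the same statements as sorried theorems (the REGISTERED stubs; `sorry` occurs nowhere else);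
* `TripartitionHard_of : Stmt.stub_rankLeComplexity → Stmt.stub_rankHard → TripartitionHard` — the
  composition, real proof; `TripartitionHard_proof : TripartitionHard := TripartitionHard_of stub_… stub_…`
  ties the two copies (the compiler checks that the `Stmt` copies and the stub statements agree).
Both stubs are DEF-FREE beyond Mathlib + `Literature.Computability.AlgebraicComplexity`
(`tensorRank`, `tripartitionTensor`, `complexity`), so each can land as
`Theorems/RyserTripartitionTripartitionHard<Stub>.lean` with `--supports stmt-ValiantsHypothesis-7160`.
Disproof used: none exists for this crux (`ledger crux ls stmt-ValiantsHypothesis-7160`: no workfiles);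
negatives index of the summit has no statement about `T_k` or tensor rank of `tripartitionTensor`.
-/

namespace Summit.ValiantsHypothesis.ValiantsHypothesis.Cruxes.TripartitionHard.Birth

open Literature.Computability.AlgebraicComplexity

/-- Statement of STUB 1 (rank-to-circuit for cubic forms; Baur–Strassen 1983 Thm. 1 = BCS 1997
Thm. (7.7), with BCS 1997 Prop. (14.1)/(14.8) `R ≤ 2 L^{ns}`). There is an absolute constant `c`
such that for every finite type `ι` and every tensor `t : ι → ι → ι → ℂ`, the tensor rank of `t` is
at most `c` times the fan-in-two circuit complexity of the trilinear form
`F_t = Σ_{i,j,l} t(i,j,l) · X_(0,i) X_(1,j) X_(2,l) ∈ ℂ[Fin 3 × ι]`.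
Why plausibly true: it is a theorem (`c = 6`): `L^{ns}(F_t) ≤ L(F_t)`
(`exists_isNonscalarSeq_length_le_complexity`), all partials `∂F_t/∂X_(0,i) = Σ_{j,l} t(i,j,l)
X_(1,j) X_(2,l)` jointly with `≤ 3 L` nonscalar multiplications (`exists_isNonscalarSeq_forall_pderiv`),
and the bilinear-coefficient tensor `(i, j, l) ↦ coeff_{X_(1,j) X_(2,l)} (∂F_t/∂X_(0,i)) = t(i,j,l)`
of that set of bilinear forms is a sum of `≤ 2 · 3L` triads (`exists_triads_of_isNonscalarSeq` with
`x j = (1, j)`, `y l = (2, l)`), whence `tensorRank_le_of_eq_sum`. Why it might fail: only by a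
mis-transcription (the `pderiv`/`coeff` computation on the triple sum is the one new calculation).
Size: M. -/
def Stmt.stub_rankLeComplexity : Prop :=
  ∃ c : ℕ, ∀ (ι : Type) [Fintype ι] (t : ι → ι → ι → ℂ),
    tensorRank t ≤ c * complexity (∑ i : ι, ∑ j : ι, ∑ l : ι,
      (MvPolynomial.C (t i j l) * MvPolynomial.X (0, i) * MvPolynomial.X (1, j) *
        MvPolynomial.X (2, l) : MvPolynomial (Fin 3 × ι) ℂ))

/-- Statement of STUB 2 (`TripartitionRankHard`, the route's layer-2 node): the tensor rank of
Pratt's balanced tripartitioning tensor satisfies `R(T_k) ≥ 8^{(1−ε)k}` for every `ε > 0` and all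
large `k` (i.e. `R(T_k) ≥ N^{log 8 / log 6.75 − o(1)} = N^{1.089−o(1)}`, `N = C(3k,k)`).
Why plausibly true: the Set Cover Conjecture implies `R(T_k) ≥ 8^k C(3k,k) C(2k,k) / 27^k ≥
(2/9) 8^k / k` for EVERY `k` (Pratt 2024, Cor. 1.12; tree named fact `pratt2024_cor_1_12`), which
gives the stub by elementary asymptotics; `R(T_k) ≤ 8^k / 2` (Pratt §1.2) shows the exponent cannot
be improved. Why it might fail: unconditionally it is an explicit super-linear tensor-rank lower
bound, beyond every rank-method certificate (`≤ 8N`, Efremenko–Garg–Oliveira–Wigderson 2018) and the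
best explicit bounds `3N − o(N)`; a rank-`(8−δ)^k` decomposition of `T_k` refutes it together with
the Set Cover Conjecture. Size: open problem (the crux's difficulty lives here, by design of the
route: HostageGlue). -/
def Stmt.stub_rankHard : Prop :=
  ∀ ε : ℝ, 0 < ε → ∃ k₀ : ℕ, ∀ k ≥ k₀,
    (8 : ℝ) ^ ((1 - ε) * (k : ℝ)) ≤ (tensorRank (tripartitionTensor ℂ k) : ℝ)

/-- Registered STUB 1 = `Stmt.stub_rankLeComplexity` (Baur–Strassen rank-to-circuit inequality for
cubic forms). [cite: BaurStrassen1983, Thm. 1] [cite: BurgisserClausenShokrollahi1997, Thm. (7.7), Prop. (14.1)] -/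
theorem stub_rankLeComplexity :
    ∃ c : ℕ, ∀ (ι : Type) [Fintype ι] (t : ι → ι → ι → ℂ),
      tensorRank t ≤ c * complexity (∑ i : ι, ∑ j : ι, ∑ l : ι,
        (MvPolynomial.C (t i j l) * MvPolynomial.X (0, i) * MvPolynomial.X (1, j) *
          MvPolynomial.X (2, l) : MvPolynomial (Fin 3 × ι) ℂ)) := by
  sorry

/-- Registered STUB 2 = `Stmt.stub_rankHard` (`R(T_k) ≥ 8^{(1−ε)k}` eventually).
[cite: Pratt2024SCC, Cor. 1.12] -/
theorem stub_rankHard :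
    ∀ ε : ℝ, 0 < ε → ∃ k₀ : ℕ, ∀ k ≥ k₀,
      (8 : ℝ) ^ ((1 - ε) * (k : ℝ)) ≤ (tensorRank (tripartitionTensor ℂ k) : ℝ) := by
  sorry

/-- The crux's inlined polynomial `T_k ∈ ℂ[Fin 3 × C([3k],k)]` (verbatim the term inside
`complexity` in `TripartitionHard`; an `abbrev`, used only inside this file's proofs). -/
noncomputable abbrev cruxPoly (k : ℕ) : MvPolynomial (Fin 3 × {A : Finset (Fin (3 * k)) // A.card = k}) ℂ :=
  ∑ S : {A : Finset (Fin (3 * k)) // A.card = k}, ∑ T : {A : Finset (Fin (3 * k)) // A.card = k},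
    ∑ U : {A : Finset (Fin (3 * k)) // A.card = k},
      if Disjoint S.1 T.1 ∧ Disjoint S.1 U.1 ∧ Disjoint T.1 U.1 then
        (MvPolynomial.X (0, S) * MvPolynomial.X (1, T) * MvPolynomial.X (2, U) :
          MvPolynomial (Fin 3 × {A : Finset (Fin (3 * k)) // A.card = k}) ℂ)
      else 0

/-- The trilinear form of `tripartitionTensor ℂ k` is literally the crux's polynomial
(`tripartitionTensor_apply`, `C 1 = 1`, `C 0 = 0`). -/
theorem trilinear_tripartitionTensor_eq (k : ℕ) :
    (∑ i : TripartitionIndex k, ∑ j : TripartitionIndex k, ∑ l : TripartitionIndex k,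
      (MvPolynomial.C (tripartitionTensor ℂ k i j l) * MvPolynomial.X (0, i) *
        MvPolynomial.X (1, j) * MvPolynomial.X (2, l) :
          MvPolynomial (Fin 3 × TripartitionIndex k) ℂ)) = cruxPoly k := by
  unfold cruxPoly
  refine Finset.sum_congr rfl fun S _ => Finset.sum_congr rfl fun T _ =>
    Finset.sum_congr rfl fun U _ => ?_
  rw [tripartitionTensor_apply]
  split_ifs <;> simp

/-- COMPOSITION (kernel-checked, no sorry): the two stub statements imply the crux
`TripartitionHard` BY NAME. -/
theorem TripartitionHard_of :
    Stmt.stub_rankLeComplexity → Stmt.stub_rankHard →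
      Summit.ValiantsHypothesis.ValiantsHypothesis.Theses.RyserTripartition.TripartitionHard := by
  intro hRL hRH
  obtain ⟨c, hc⟩ := hRL
  intro ε hε
  -- shrink ε to δ := min ε 1 ∈ (0, 1]
  set δ : ℝ := min ε 1 with hδ
  have hδpos : 0 < δ := lt_min hε one_pos
  have hδε : δ ≤ ε := min_le_left _ _
  -- STUB 2 at δ / 2
  obtain ⟨k₁, hk₁⟩ := hRH (δ / 2) (by positivity)
  -- absorb the constant: c < (8^(δ/2))^k for k ≥ k₂
  have hbase : (1 : ℝ) < (8 : ℝ) ^ (δ / 2) := Real.one_lt_rpow (by norm_num) (by positivity)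
  obtain ⟨k₂, hk₂⟩ := add_one_pow_unbounded_of_pos (c : ℝ) (sub_pos.2 hbase)
  rw [sub_add_cancel] at hk₂
  refine ⟨max k₁ k₂, fun k hk => ?_⟩
  have hk1 : k₁ ≤ k := (le_max_left _ _).trans hk
  have hk2 : k₂ ≤ k := (le_max_right _ _).trans hk
  -- rank lower bound at k
  have hR : (8 : ℝ) ^ ((1 - δ / 2) * (k : ℝ)) ≤ (tensorRank (tripartitionTensor ℂ k) : ℝ) :=
    hk₁ k hk1
  -- rank ≤ c · complexity of the crux polynomial
  have hRC : (tensorRank (tripartitionTensor ℂ k) : ℝ) ≤ (c : ℝ) * (complexity (cruxPoly k) : ℝ) := by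
    have h := hc (TripartitionIndex k) (tripartitionTensor ℂ k)
    rw [trilinear_tripartitionTensor_eq] at h
    exact_mod_cast h
  -- c ≤ B := 8^((δ/2) k)
  have hB : (c : ℝ) ≤ (8 : ℝ) ^ (δ / 2 * (k : ℝ)) := by
    rw [Real.rpow_mul (by norm_num : (0 : ℝ) ≤ 8), Real.rpow_natCast]
    exact (hk₂.trans_le (pow_le_pow_right₀ hbase.le hk2)).le
  have hBpos : 0 < (8 : ℝ) ^ (δ / 2 * (k : ℝ)) := Real.rpow_pos_of_pos (by norm_num) _
  have hL : 0 ≤ (complexity (cruxPoly k) : ℝ) := Nat.cast_nonneg _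
  -- monotonicity in ε
  have hA : (8 : ℝ) ^ ((1 - ε) * (k : ℝ)) ≤ (8 : ℝ) ^ ((1 - δ) * (k : ℝ)) :=
    Real.rpow_le_rpow_of_exponent_le (by norm_num)
      (mul_le_mul_of_nonneg_right (by linarith) (Nat.cast_nonneg k))
  have hsplit : (8 : ℝ) ^ ((1 - δ) * (k : ℝ)) * (8 : ℝ) ^ (δ / 2 * (k : ℝ)) =
      (8 : ℝ) ^ ((1 - δ / 2) * (k : ℝ)) := by
    rw [← Real.rpow_add (by norm_num : (0 : ℝ) < 8)]
    congr 1
    ring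
  have key : (8 : ℝ) ^ ((1 - δ) * (k : ℝ)) * (8 : ℝ) ^ (δ / 2 * (k : ℝ)) ≤
      (complexity (cruxPoly k) : ℝ) * (8 : ℝ) ^ (δ / 2 * (k : ℝ)) :=
    calc (8 : ℝ) ^ ((1 - δ) * (k : ℝ)) * (8 : ℝ) ^ (δ / 2 * (k : ℝ))
          = (8 : ℝ) ^ ((1 - δ / 2) * (k : ℝ)) := hsplit
      _ ≤ (tensorRank (tripartitionTensor ℂ k) : ℝ) := hR
      _ ≤ (c : ℝ) * (complexity (cruxPoly k) : ℝ) := hRC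
      _ ≤ (8 : ℝ) ^ (δ / 2 * (k : ℝ)) * (complexity (cruxPoly k) : ℝ) :=
          mul_le_mul_of_nonneg_right hB hL
      _ = (complexity (cruxPoly k) : ℝ) * (8 : ℝ) ^ (δ / 2 * (k : ℝ)) := mul_comm _ _
  have hfin : (8 : ℝ) ^ ((1 - δ) * (k : ℝ)) ≤ (complexity (cruxPoly k) : ℝ) :=
    le_of_mul_le_mul_right key hBpos
  exact hA.trans hfin

/-- THE SKELETON: the crux, modulo exactly the two registered stubs (the compiler checks that the
`Stmt` copies and the stub statements agree). -/
theorem TripartitionHard_proof :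
    Summit.ValiantsHypothesis.ValiantsHypothesis.Theses.RyserTripartition.TripartitionHard :=
  TripartitionHard_of stub_rankLeComplexity stub_rankHard

end Summit.ValiantsHypothesis.ValiantsHypothesis.Cruxes.TripartitionHard.Birth
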